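import Literature.MathematicalPhysics.QuantumFieldTheory.Balaban1983to89.B12
import Literature.MathematicalPhysics.QuantumFieldTheory.Balaban1983to89.B12FarTerms36

/-!
# `Balaban1983to89.B12NearTerms321` — [Balaban1987RG1] (3.18)–(3.23) pp. 273–274: the terms with `X ⊂ □̃²`
(rewriting through the cond-(iv) functions `U_j(□₀)` (3.18)–(3.19), the constraint identity (3.20), the
`ζ̃_□`-split (3.21), the configuration `B̃_□` (3.22), and (3.23))

HONEST FRAMING (cell `lit-balaban`, verbatim): statement-level skeleton of published theorems with citation tags; proofs where landed; nothing here is a claim about the Yang–Mills mass gap.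

CITATION HEADER.  T. Bałaban, *Renormalization group approach to lattice gauge field theories. I. Generation of
effective actions in a small field approximation and a coupling constant renormalization in four dimensions*,
Commun. Math. Phys. **109** (1987) 249–301, doi:10.1007/bf01215223 [Balaban1987RG1] (cell paper B12; held text
`paper:balaban1987-cmp109-rg-i-small-field`, journal page = PDF page + 248; the displays were READ AS IMAGES from
the page renders `b2b-balaban-ref1/pages/1987-cmp109-rg-I-small-field/…-p025-x2.png` (p. 273), `…-p026-x2.png`
(p. 274) and `…-p027-x2.png` (p. 275), the OCR of the held text being unusable for (3.18)–(3.23)).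
Unit `lit-balaban-r09` gen 4 (reader/typer of B12, display owner), SKELETON rows `B12.Eq3.18-3.19`, `B12.Eq3.20`
(both `absent` before this file) and the residue «B̃_□ (3.22) not typed» of `B12.Def@274` (fold owner r20);
HOME `run/shared/lean/pub/lit-balaban/`.  Sibling modules, imported and used BY NAME: `B12FirstExpansion34` (row
`B12.Eq3.3-3.4`, the first expansion (3.4), r20), `B12FarTerms36` (rows `B12.Eq3.6-3.8`, the far terms, p32:
`Bsq` = B_□, `eq36`, `deriv_rhs37`), `B12` (`exp_neg_inv_le_pow`, the «small factor O((Lʲη)ᴺ)» inequality).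

WHAT IS PRINTED (pp. 273–275 [PDF 25–27], verbatim; `□̃ⁿ`, `□₀ = □̃⁵`, `ζ_□` as on pp. 257, 270, 273).
*«Now we consider the fundamental case, the case when the second condition in (3.5) is satisfied, i.e. when
X ⊂ □̃². […] To do the analysis we transform the terms in (3.4). We take the function U_j constructed for the cube
□₀ = □̃⁵ as in the condition (iv) in the definition of spaces U^c_j. Thus we construct a sequence of cubes {□_n},
n = 0, 1, …, k+1, satisfying the conditions (1.3)–(1.6) [14] (with k+1, L⁻¹η instead of k, η, R = R₁), hence
□̃⁴ ⊂ □_{k+1}. For this sequence we construct the functions U_j, j = 1, 2, …, k+1, which we denote by U_j(□₀). The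
configuration in terms of (3.4) with localization domains X satisfying X ⊂ □̃² can be written as
  U_j(exp iB_□ Ū^j_{k+1}) = U_j(□₀, M˙(U_j(exp iB_□ Ū^j_{k+1}))).   (3.18)
Using the gauge invariance, and similar transformations as in (3.3), we obtain
  𝐄^{(j)}(X, U_j(exp iB_□ Ū^j_{k+1})) = 𝐄^{(j)}(X, U_j(□₀, exp iQ(ξ𝐇_j(B_□)) M˙(U_{k+1}))).   (3.19)
For the expression under the exponential function above we have
  Q(ξ𝐇_j(B_□)) = Q_j(ξU_j(B_□)) = B_□ on a neighborhood of □̃⁴.   (3.20)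
Later it will be important to have the configuration B_□ only, instead of the expression on the left hand side,
so we remove from (3.19) a part of this expression localized outside □̃³. Take a function ζ̃_□ ∈ C₀^∞(□₀), ζ̃_□ = 1
on □̃³, ζ̃_□ = 0 outside □̃⁴. We have
  𝐄^{(j)}(X, U_j(□₀, exp iQ(ξ𝐇_j(B_□)) M˙(U_{k+1})))
   = 𝐄^{(j)}(X, U_j(□₀, exp iζ̃_□B_□ M˙(U_{k+1})))
     + ∫₀¹ dt̃ (d/dt̃) 𝐄^{(j)}(X, exp iξ𝐇_j(□₀, (t̃(1 − ζ̃_□) + ζ̃_□)Q(ξ𝐇_j(B_□))) U_{k+1})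
   = 𝐄^{(j)}(X, U_j(□₀, exp iζ̃_□B_□ M˙(U_{k+1})))
     + ∫₀¹ dt̃ (d/dt̃_□) 𝐄^{(j)}(X, exp iξ[𝐇_j(□₀, (t̃(1 − ζ̃_□) + ζ̃_□)Q(ξ𝐇_j(B_□)))
        + t̃_□ ⟨((δ/δB)𝐇_j)(□₀, (t̃(1 − ζ̃_□) + ζ̃_□)Q(ξ𝐇_j(B_□))), (1 − ζ̃_□)Q(ξ𝐇_j(B_□))⟩] U_{k+1})|_{t̃_□=0}.  (3.21)
Again, from the exponential decay of the derivative (δ/δB)𝐇_j, and from the condition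
dist^{(ξ)}(X, supp(1 − ζ̃_□)) ≥ M(Lʲη)⁻¹, we obtain a bound of the type (3.9) for the expression ⟨…⟩ under the
exponential. Thus a bound for the second term above has the small factor O((Lʲη)ᴺ), and we treat this term in
exactly the same way as the terms (3.7) before […]. To simplify some formulas in the future we change the first term
on the right-hand side of the last equality in (3.21). Taking into account the definition of B_□, we write
  ζ̃_□B_□ = [ζ̃_□Q_j(η(t + t_□ζ_□)𝐇_k(B′)) − Q_j(η(tζ̃_□ + t_□ζ_□)𝐇_k(B′))] + B̃_□,
  B̃_□ = Q_j(η(tζ̃_□ + t_□ζ_□)𝐇_k(B′)).   (3.22)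
We remove the expression in the square brackets […] repeating the procedure in (3.21). The expression is localized
in □̃⁴∖□̃³ […]. Thus we consider the expression
  𝐄^{(j)}(X, U_j(□₀, exp iB̃_□ M˙(U_{k+1}))) = 𝐄^{(j)}(X, U_j(□₀, exp iB̃_□ M˙(U_{k+1}(□₀, M˙(U_{k+1}))))).   (3.23)
This equality is connected with the way we introduce the variables 𝐔, 𝐉, namely in the interior averages
M˙(U_{k+1}) we replace the configuration U_{k+1} by 𝐔.»*  ([14] = [Balaban1985RegularSpaces], [15] =
[Balaban1985Variational], [12] = [Balaban1985Averaging]; B_□ = Q_j(η(t + t_□ζ_□)𝐇_k(B′)) is the unnumbered display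
of p. 271, `B12FarTerms36.Bsq`.)

HOW IT IS FORMALIZED (the dictionary; all modelling choices are here — the Mathlib-calculus model of the two
siblings, extended by the objects of pp. 273–274).
* Configuration-space rewritings (3.18), (3.19), (3.23) (§1, §5): configurations `𝒰`, block-average
  configurations `𝒱` (the values of the «interior averages» M˙), gauge groups `𝒢`, `𝒢'` acting by `•` on `𝒰`,
  `𝒱`; `E : 𝒰 → F` = U ↦ 𝐄^{(j)}(X, U); `M : 𝒰 → 𝒱` = M˙; `rep : EB → 𝒰` = B ↦ U_j(exp iB Ū^j_{k+1}) (the sibling's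
  `rep`); `rep0 : 𝒱 → 𝒰` = V ↦ U_j(□₀, V), the cond-(iv) function for the cube sequence {□_n}; `chart : EH → 𝒰` =
  𝐇 ↦ exp iξ𝐇 U_{k+1} (the sibling's `chart`); `chartV : EB → 𝒱` = A ↦ exp iA M˙(U_{k+1}); `Qavg : EH → EB` =
  𝐇 ↦ Q(ξ𝐇).  (3.18) is TYPED as the input shape `Eq318` (the reproduction of a minimal configuration by the
  cond-(iv) function from its own averages — a property of the constructions of [14] (1.3)–(1.6) / [15], NOT
  reproduced here, same status as (3.3) in `B12FirstExpansion34`); (3.19) is PROVED (`eq319`) from (3.18) and the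
  named inputs of «the gauge invariance, and similar transformations as in (3.3)»: gauge invariance of 𝐄^{(j)}(X,·)
  (`hE`), gauge covariance of M˙ (`hM`) and of U_j(□₀,·) (`hrep0`), the Sect. G [15] representation of
  U_j(exp iB Ū^j_{k+1}) as a gauge transform of exp iξ𝐇_j(B)U_{k+1} (`hrep`, the hypothesis of
  `B12FarTerms36.eq36`), and the (97)/(159) [12]-type identity M˙(exp iξ𝐇 U_{k+1}) = [exp iQ(ξ𝐇) M˙(U_{k+1})]^{gauge}
  defining Q (`hQ`); (3.23) is PROVED (`eq323`) from the constraint input M˙(U_{k+1}(□₀, M˙(U_{k+1}))) = M˙(U_{k+1})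
  (the cond-(iv) function has the prescribed interior averages).
* (3.20) and the localisation (§2): bond functions `ι → V` (`ι` the bonds, `V` ∋ 𝔤ᶜ a normed `𝕜`-space),
  «multiplication by ζ̃_□» = the continuous linear map `mulFn z` of pointwise multiplication by the scalar function
  `z : ι → 𝕜` (the values of ζ̃_□ at the bonds); (3.20) is TYPED as the input shape `Eq320` — equality of
  Q(ξ𝐇_j(B_□)) and B_□ on a set `N` of bonds («a neighborhood of □̃⁴»; an identity of [15] Sect. G, NOT reproduced;
  the middle member Q_j(ξU_j(B_□)), the same field computed from the function U_j of [15] before the passage to 𝐇_j,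
  is not modelled separately) — and what (3.21) USES of it is PROVED: with «ζ̃_□ = 0 outside □̃⁴» (`z = 0` off `N`),
  ζ̃_□Q(ξ𝐇_j(B_□)) = ζ̃_□B_□ (`mulFn_eq_of_eq320`).
* (3.21) (§3): over a field `𝕜` (ℝ for the FTC, any nontrivially normed field for the chain rules): `Z : EB →L[𝕜] EB`
  (multiplication by ζ̃_□; `mulFn z` in the bond model), `q` = Q(ξ𝐇_j(B_□)), `b` = B_□, the interpolation
  `path Z q t̃ = ζ̃_□q + t̃(q − ζ̃_□q) = (t̃(1 − ζ̃_□) + ζ̃_□)q` (`path_eq_printed`), `Hj0 : EB → EH` = A ↦ 𝐇_j(□₀, A),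
  `Gc : EH → F` = 𝐇 ↦ 𝐄^{(j)}(X, exp iξ𝐇 U_{k+1}) (= `E ∘ chart`), `rep0V : EB → 𝒰` = A ↦ U_j(□₀, exp iA M˙(U_{k+1}))
  (= `rep0 ∘ chartV`) with the □₀-local Sect. G representation `hrep0V : ∀ A ∈ D₀, ∃ g, rep0V A = g • chart (Hj0 A)`.
  PROVED: the first equality of (3.21) = the fundamental theorem of calculus along `path` (`ftc_path`,
  `eq321_first`: the t̃ = 1 end is q, the t̃ = 0 end is ζ̃_□q = ζ̃_□B_□ by `hloc : Z q = Z b`), the second equality =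
  the chain rule through 𝐇_j(□₀,·) written as the t̃_□-derivative at 0 (`deriv_comp_path_eq_tbox`, via
  `B12FarTerms36.deriv_rhs37`), assembled in `eq321`; the bond-model instance with (3.20) as hypothesis is
  `eq321_of_eq320`.  Smoothness hypotheses: 𝐇_j(□₀,·) of class C¹ on an open set containing the segment and
  𝐄^{(j)}(X, exp iξ · U_{k+1}) of class C¹ on an open set containing its image (print: analyticity on the spaces
  (3.16)/(3.24)).
* (3.22) (§4): in the sibling's model of p. 271 (`EA` ∋ 𝐀, `x = t𝐇_k(B′)`, `v = ζ_□𝐇_k(B′)`, `Q : EA → EB` = 𝐀 ↦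
  Q_j(η𝐀), B_□ = `Bsq Q x v t_□`), with `ZA : EA →L[𝕜] EA` the multiplication by ζ̃_□ on the fine fields (so
  `ZA x + t_□ • v = (tζ̃_□ + t_□ζ_□)𝐇_k(B′)`): **B̃_□ is DEFINED with body** (`Btilde`), and (3.22) is the identity
  `eq322`.
* The sentence after (3.21) (§6): the geometry «dist^{(ξ)}(X, supp(1 − ζ̃_□)) ≥ M(Lʲη)⁻¹» for X ⊂ □̃² =
  `cthickening (2R₀) □` and supp(1 − ζ̃_□) ⊆ closure (□̃³)ᶜ, □̃³ = `cthickening (3R₀) □` (R₀ = M(Lʲη)⁻¹, the cubes as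
  metric thickenings exactly as in `B12Cubes436`), in ANY pseudo-metric space (`le_dist_of_tilde2_of_closure_compl_tilde3`),
  and the arithmetic «a bound of the type (3.9) … has the small factor O((Lʲη)ᴺ)»: K e^{−½δ₀·dist} with
  dist ≥ M(Lʲη)⁻¹ is ≤ K·(N!/(½δ₀M)ᴺ)·(Lʲη)ᴺ (`smallFactor321`, by `B12.exp_neg_inv_le_pow`).
NOT HERE (not claimed): the constructions of [14]/[15] behind the inputs (3.18), (3.20), `hrep`, `hrep0V`, `hQ`,
`hM`, `hrep0` and the constraint input of (3.23); the bound «of the type (3.9)» itself for the ⟨…⟩ of (3.21) (row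
`B12.Eq3.9`, module `B12Ineq39`, enters `smallFactor321` as the hypothesis `hT`); the locality sentence «The
expression is localized in □̃⁴∖□̃³» for the bracket of (3.22) (needs the locality of Q_j); (3.24) sqq. (rows
`B12.Eq3.24-3.25` ff., typed in `B12Sec2to5`).  Everything below is PROVED from Mathlib and the two siblings; the
only `def`s are the three objects WITH BODIES (`mulFn`, `path`, `Btilde`) and the two input shapes `Eq318`, `Eq320`
(predicates with explicit arguments, used as hypotheses of the theorems — no closed `Prop` fact, no `sorry`, no axiom).
-/

namespace Literature.MathematicalPhysics.QuantumFieldTheory.Balaban1983to89.B12NearTerms321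

open Set Filter Metric MeasureTheory intervalIntegral
open scoped Topology BigOperators Nat
open Literature.MathematicalPhysics.QuantumFieldTheory.Balaban1983to89.B12FarTerms36 (Bsq Bsq_apply eq36 deriv_rhs37)

/-! ## §1. (3.18) and (3.19): rewriting through the cond-(iv) functions `U_j(□₀)` -/

section Rewriting

variable {𝒰 𝒱 𝒢 𝒢' : Type*} [SMul 𝒢 𝒰] [SMul 𝒢' 𝒱] {EB EH F : Type*}

/-- **(3.18)** p. 273, as an input shape: *«The configuration in terms of (3.4) with localization domains X
satisfying X ⊂ □̃² can be written as U_j(exp iB_□ Ū^j_{k+1}) = U_j(□₀, M˙(U_j(exp iB_□ Ū^j_{k+1})))»* — on the domain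
`D` of fields B considered, the configuration `rep B` = U_j(exp iB Ū^j_{k+1}) is reproduced by the cond-(iv) function
`rep0` = U_j(□₀, ·) ([14] (1.3)–(1.6), «which we denote by U_j(□₀)») from its own interior averages `M` = M˙.  A
property of the constructions of [14]/[15]; typed, not reproduced. [cite: Balaban1987RG1, (3.18) p.273] -/
def Eq318 (rep : EB → 𝒰) (rep0 : 𝒱 → 𝒰) (M : 𝒰 → 𝒱) (D : Set EB) : Prop :=
  ∀ B ∈ D, rep B = rep0 (M (rep B))

omit [SMul 𝒢 𝒰] [SMul 𝒢' 𝒱] in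
/-- Unfolding of the input shape (3.18) at one field `B ∈ D`. [cite: Balaban1987RG1, (3.18) p.273] -/
theorem eq318_apply {rep : EB → 𝒰} {rep0 : 𝒱 → 𝒰} {M : 𝒰 → 𝒱} {D : Set EB} (h : Eq318 rep rep0 M D) {B : EB}
    (hB : B ∈ D) : rep B = rep0 (M (rep B)) :=
  h B hB

/-- **(3.19)** p. 274: *«Using the gauge invariance, and similar transformations as in (3.3), we obtain
𝐄^{(j)}(X, U_j(exp iB_□ Ū^j_{k+1})) = 𝐄^{(j)}(X, U_j(□₀, exp iQ(ξ𝐇_j(B_□)) M˙(U_{k+1})))»* — PROVED from the named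
inputs: `hE` gauge invariance of 𝐄^{(j)}(X, ·); `hM` gauge covariance of the averages M˙; `hrep0` gauge covariance of
the cond-(iv) function U_j(□₀, ·); `hrep` the Sect. G [15] representation of U_j(exp iB Ū^j_{k+1}) as a gauge
transform of exp iξ𝐇_j(B)U_{k+1} on `D` (the hypothesis of `B12FarTerms36.eq36`, used at (3.3)/(3.6)); `hQ` the
identity M˙(exp iξ𝐇 U_{k+1}) = [exp iQ(ξ𝐇) M˙(U_{k+1})]^{gauge} behind «the equality (97) [12]» of (3.3) (definition of
the average Q of Lie-algebra fields); `h318` = (3.18).  Stated at any `B ∈ D` (in print `B = B_□`).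
[cite: Balaban1987RG1, (3.19) p.274] -/
theorem eq319 {E : 𝒰 → F} (hE : ∀ (g : 𝒢) (U : 𝒰), E (g • U) = E U)
    {M : 𝒰 → 𝒱} (hM : ∀ (g : 𝒢) (U : 𝒰), ∃ g' : 𝒢', M (g • U) = g' • M U)
    {rep0 : 𝒱 → 𝒰} (hrep0 : ∀ (g' : 𝒢') (W : 𝒱), ∃ g : 𝒢, rep0 (g' • W) = g • rep0 W)
    {rep : EB → 𝒰} {chart : EH → 𝒰} {Hj : EB → EH} {D : Set EB}
    (hrep : ∀ B ∈ D, ∃ g : 𝒢, rep B = g • chart (Hj B))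
    {chartV : EB → 𝒱} {Qavg : EH → EB} (hQ : ∀ H : EH, ∃ g' : 𝒢', M (chart H) = g' • chartV (Qavg H))
    (h318 : Eq318 rep rep0 M D) {B : EB} (hB : B ∈ D) :
    E (rep B) = E (rep0 (chartV (Qavg (Hj B)))) := by
  obtain ⟨g, hg⟩ := hrep B hB
  obtain ⟨g₁, hg₁⟩ := hM g (chart (Hj B))
  obtain ⟨g₂, hg₂⟩ := hQ (Hj B)
  obtain ⟨g₃, hg₃⟩ := hrep0 g₁ (M (chart (Hj B)))
  obtain ⟨g₄, hg₄⟩ := hrep0 g₂ (chartV (Qavg (Hj B)))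
  rw [h318 B hB, hg, hg₁, hg₃, hE, hg₂, hg₄, hE]

/-- (3.18)–(3.19) combined with the Sect. G representation on □₀: if moreover U_j(□₀, exp iA M˙(U_{k+1})) is a gauge
transform of exp iξ𝐇_j(□₀, A)U_{k+1} for `A = Q(ξ𝐇_j(B))` (`hrep0V`, the □₀-local form of `hrep` used in (3.21)), then
𝐄^{(j)}(X, U_j(exp iB_□ Ū^j_{k+1})) = 𝐄^{(j)}(X, exp iξ𝐇_j(□₀, Q(ξ𝐇_j(B_□)))U_{k+1}) — the function whose t̃-interpolation
is differentiated in (3.21). [cite: Balaban1987RG1, (3.19) p.274] -/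
theorem eq319_chart {E : 𝒰 → F} (hE : ∀ (g : 𝒢) (U : 𝒰), E (g • U) = E U)
    {M : 𝒰 → 𝒱} (hM : ∀ (g : 𝒢) (U : 𝒰), ∃ g' : 𝒢', M (g • U) = g' • M U)
    {rep0 : 𝒱 → 𝒰} (hrep0 : ∀ (g' : 𝒢') (W : 𝒱), ∃ g : 𝒢, rep0 (g' • W) = g • rep0 W)
    {rep : EB → 𝒰} {chart : EH → 𝒰} {Hj : EB → EH} {D : Set EB}
    (hrep : ∀ B ∈ D, ∃ g : 𝒢, rep B = g • chart (Hj B))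
    {chartV : EB → 𝒱} {Qavg : EH → EB} (hQ : ∀ H : EH, ∃ g' : 𝒢', M (chart H) = g' • chartV (Qavg H))
    (h318 : Eq318 rep rep0 M D) {Hj0 : EB → EH} {D₀ : Set EB}
    (hrep0V : ∀ A ∈ D₀, ∃ g : 𝒢, rep0 (chartV A) = g • chart (Hj0 A))
    {B : EB} (hB : B ∈ D) (hA : Qavg (Hj B) ∈ D₀) :
    E (rep B) = E (chart (Hj0 (Qavg (Hj B)))) := by
  rw [eq319 hE hM hrep0 hrep hQ h318 hB]
  exact eq36 (rep := fun A => rep0 (chartV A)) hE hrep0V hA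

end Rewriting

/-! ## §2. (3.20) and the localisation `ζ̃_□Q(ξ𝐇_j(B_□)) = ζ̃_□B_□` (bond-function model) -/

section Localization

variable {𝕜 : Type*} [NontriviallyNormedField 𝕜] {ι : Type*}
  {V : Type*} [NormedAddCommGroup V] [NormedSpace 𝕜 V] {EH : Type*}

variable (V) in
/-- «Multiplication by ζ̃_□» on bond functions `ι → V`: the continuous linear map of pointwise multiplication by the
scalar function `z : ι → 𝕜` (the values of ζ̃_□ at the bonds; `1 − z` for `1 − ζ̃_□`).
[cite: Balaban1987RG1, (3.21) p.274] -/
def mulFn (z : ι → 𝕜) : (ι → V) →L[𝕜] (ι → V) :=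
  ContinuousLinearMap.pi fun i => z i • ContinuousLinearMap.proj i

/-- Pointwise formula `(ζ̃_□B)(b) = ζ̃_□(b)B(b)`. [cite: Balaban1987RG1, (3.21) p.274] -/
@[simp] theorem mulFn_apply (z : ι → 𝕜) (B : ι → V) (i : ι) : mulFn V z B i = z i • B i := by
  simp [mulFn]

/-- Localisation: if two bond functions agree on a set `N` of bonds and `ζ̃_□` vanishes off `N`, their products
with `ζ̃_□` agree everywhere. [cite: Balaban1987RG1, (3.21) p.274] -/
theorem mulFn_congr_of_eqOn {z : ι → 𝕜} {N : Set ι} (hz : ∀ i ∉ N, z i = 0) {q b : ι → V}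
    (hqb : ∀ i ∈ N, q i = b i) : mulFn V z q = mulFn V z b := by
  ext i
  by_cases hi : i ∈ N
  · simp [mulFn_apply, hqb i hi]
  · simp [mulFn_apply, hz i hi]

/-- **(3.20)** p. 274, as an input shape: *«For the expression under the exponential function above we have
Q(ξ𝐇_j(B_□)) = Q_j(ξU_j(B_□)) = B_□ on a neighborhood of □̃⁴»* — the average `Qavg` = Q(ξ ·) of «the function 𝐇_j»
([15] Sect. G) evaluated at `b` = B_□ reproduces B_□ on the set `N` of bonds (the neighbourhood of □̃⁴).  An identity
of the variational constructions of [15], typed, not reproduced; the middle member Q_j(ξU_j(B_□)) (the same field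
computed from the function U_j of [15]) is not modelled separately. [cite: Balaban1987RG1, (3.20) p.274] -/
def Eq320 (Qavg : EH → (ι → V)) (Hj : (ι → V) → EH) (N : Set ι) (b : ι → V) : Prop :=
  ∀ i ∈ N, Qavg (Hj b) i = b i

/-- What (3.21) uses of (3.20): with «ζ̃_□ = 0 outside □̃⁴» (`z = 0` off the neighbourhood `N` of □̃⁴ on which (3.20)
holds), `ζ̃_□Q(ξ𝐇_j(B_□)) = ζ̃_□B_□` — the t̃ = 0 end of the interpolation in (3.21) is the configuration ζ̃_□B_□ of its
first term. [cite: Balaban1987RG1, (3.21) p.274] -/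
theorem mulFn_eq_of_eq320 {Qavg : EH → (ι → V)} {Hj : (ι → V) → EH} {N : Set ι} {b : ι → V}
    (h320 : Eq320 Qavg Hj N b) {z : ι → 𝕜} (hz : ∀ i ∉ N, z i = 0) :
    mulFn V z (Qavg (Hj b)) = mulFn V z b :=
  mulFn_congr_of_eqOn hz h320

end Localization

/-! ## §3. (3.21): the `ζ̃_□`-split — FTC along `t̃ ↦ (t̃(1 − ζ̃_□) + ζ̃_□)Q(ξ𝐇_j(B_□))` and the chain rule -/

section Path

variable {𝕜 : Type*} [NontriviallyNormedField 𝕜] {EB EH F : Type*} [NormedAddCommGroup EB] [NormedSpace 𝕜 EB]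
  [NormedAddCommGroup EH] [NormedSpace 𝕜 EH] [NormedAddCommGroup F] [NormedSpace 𝕜 F]

/-- The interpolation of (3.21): `A(t̃) = (t̃(1 − ζ̃_□) + ζ̃_□)Q = ζ̃_□Q + t̃(Q − ζ̃_□Q)` between `ζ̃_□Q` (t̃ = 0) and
`Q` (t̃ = 1), for `Z` = multiplication by ζ̃_□ and `q` = Q(ξ𝐇_j(B_□)). [cite: Balaban1987RG1, (3.21) p.274] -/
def path (Z : EB →L[𝕜] EB) (q : EB) (t : 𝕜) : EB :=
  Z q + t • (q - Z q)

omit [NormedAddCommGroup EH] [NormedSpace 𝕜 EH] [NormedAddCommGroup F] [NormedSpace 𝕜 F] in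
/-- Unfolding of `path`. [cite: Balaban1987RG1, (3.21) p.274] -/
theorem path_apply (Z : EB →L[𝕜] EB) (q : EB) (t : 𝕜) : path Z q t = Z q + t • (q - Z q) := rfl

omit [NormedAddCommGroup EH] [NormedSpace 𝕜 EH] [NormedAddCommGroup F] [NormedSpace 𝕜 F] in
/-- The printed form: `(t̃(1 − ζ̃_□) + ζ̃_□)Q = t̃((1 − ζ̃_□)Q) + ζ̃_□Q` with `1 − ζ̃_□` the operator `1 − Z`.
[cite: Balaban1987RG1, (3.21) p.274] -/
theorem path_eq_printed (Z : EB →L[𝕜] EB) (q : EB) (t : 𝕜) :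
    path Z q t = t • (((1 : EB →L[𝕜] EB) - Z) q) + Z q := by
  have h1 : ((1 : EB →L[𝕜] EB) - Z) q = q - Z q := rfl
  rw [h1, path, add_comm]

omit [NormedAddCommGroup EH] [NormedSpace 𝕜 EH] [NormedAddCommGroup F] [NormedSpace 𝕜 F] in
/-- t̃ = 0 end: `ζ̃_□Q`. [cite: Balaban1987RG1, (3.21) p.274] -/
@[simp] theorem path_zero (Z : EB →L[𝕜] EB) (q : EB) : path Z q 0 = Z q := by
  simp [path]

omit [NormedAddCommGroup EH] [NormedSpace 𝕜 EH] [NormedAddCommGroup F] [NormedSpace 𝕜 F] in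
/-- t̃ = 1 end: `Q`. [cite: Balaban1987RG1, (3.21) p.274] -/
@[simp] theorem path_one (Z : EB →L[𝕜] EB) (q : EB) : path Z q 1 = q := by
  simp [path]

omit [NormedAddCommGroup EH] [NormedSpace 𝕜 EH] [NormedAddCommGroup F] [NormedSpace 𝕜 F] in
/-- `(d/dt̃)A(t̃) = (1 − ζ̃_□)Q = Q − ζ̃_□Q`. [cite: Balaban1987RG1, (3.21) p.274] -/
theorem hasDerivAt_path (Z : EB →L[𝕜] EB) (q : EB) (t : 𝕜) : HasDerivAt (path Z q) (q - Z q) t := by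
  have h : HasDerivAt (fun s : 𝕜 => Z q + s • (q - Z q)) (q - Z q) t := by
    simpa using (HasDerivAt.smul_const (hasDerivAt_id t) (q - Z q)).const_add (Z q)
  exact h

omit [NormedAddCommGroup EH] [NormedSpace 𝕜 EH] [NormedAddCommGroup F] [NormedSpace 𝕜 F] in
/-- `A(t̃)` is continuous in t̃. [cite: Balaban1987RG1, (3.21) p.274] -/
theorem continuous_path (Z : EB →L[𝕜] EB) (q : EB) : Continuous (path Z q) :=
  continuous_const.add (continuous_id.smul continuous_const)

/-- Chain rule along the interpolation: for `Hj0` = A ↦ 𝐇_j(□₀, A) differentiable at `A(t̃)` and `Gc` = 𝐇 ↦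
𝐄^{(j)}(X, exp iξ𝐇 U_{k+1}) differentiable at `𝐇_j(□₀, A(t̃))`,
`(d/dt̃) 𝐄^{(j)}(X, exp iξ𝐇_j(□₀, A(t̃))U_{k+1}) = ⟨DGc(𝐇_j(□₀, A(t̃))), ⟨D𝐇_j(□₀, ·)(A(t̃)), (1 − ζ̃_□)Q⟩⟩`.
[cite: Balaban1987RG1, (3.21) p.274] -/
theorem hasDerivAt_comp_path {Hj0 : EB → EH} {Gc : EH → F} {Z : EB →L[𝕜] EB} {q : EB} {t : 𝕜}
    (hH : DifferentiableAt 𝕜 Hj0 (path Z q t)) (hG : DifferentiableAt 𝕜 Gc (Hj0 (path Z q t))) :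
    HasDerivAt (fun s : 𝕜 => Gc (Hj0 (path Z q s)))
      (fderiv 𝕜 Gc (Hj0 (path Z q t)) (fderiv 𝕜 Hj0 (path Z q t) (q - Z q))) t := by
  have h1 : HasDerivAt (fun s : 𝕜 => Hj0 (path Z q s)) (fderiv 𝕜 Hj0 (path Z q t) (q - Z q)) t :=
    hH.hasFDerivAt.comp_hasDerivAt t (hasDerivAt_path Z q t)
  exact hG.hasFDerivAt.comp_hasDerivAt t h1

/-- **(3.21), second equality**, pointwise in t̃: the t̃-derivative of 𝐄^{(j)}(X, exp iξ𝐇_j(□₀, A(t̃))U_{k+1}) equals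
the t̃_□-derivative at t̃_□ = 0 of 𝐄^{(j)}(X, exp iξ[𝐇_j(□₀, A(t̃)) + t̃_□⟨((δ/δB)𝐇_j)(□₀, A(t̃)), (1 − ζ̃_□)Q⟩]U_{k+1})
— the first-order replacement of 𝐇_j(□₀, A(t̃ + t̃_□)) inside a derivative at t̃_□ = 0 (as in (3.7); right member by
`B12FarTerms36.deriv_rhs37`). [cite: Balaban1987RG1, (3.21) p.274] -/
theorem deriv_comp_path_eq_tbox {Hj0 : EB → EH} {Gc : EH → F} {Z : EB →L[𝕜] EB} {q : EB} {t : 𝕜}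
    (hH : DifferentiableAt 𝕜 Hj0 (path Z q t)) (hG : DifferentiableAt 𝕜 Gc (Hj0 (path Z q t))) :
    deriv (fun s : 𝕜 => Gc (Hj0 (path Z q s))) t
      = deriv (fun τ : 𝕜 => Gc (Hj0 (path Z q t) + τ • fderiv 𝕜 Hj0 (path Z q t) (q - Z q))) 0 := by
  rw [(hasDerivAt_comp_path hH hG).deriv, deriv_rhs37 _ hG]

end Path

section FTC

variable {EB EH F : Type*} [NormedAddCommGroup EB] [NormedSpace ℝ EB] [NormedAddCommGroup EH] [NormedSpace ℝ EH]
  [NormedAddCommGroup F] [NormedSpace ℝ F] [CompleteSpace F]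

omit [NormedAddCommGroup EH] [NormedSpace ℝ EH] [CompleteSpace F] in
/-- Continuity on `[0,1]` of `t̃ ↦ ⟨Df(A(t̃)), w⟩` for `f` of class C¹ on an open `s ⊇ A([0,1])` (integrability of the
integrands of (3.21)). [cite: Balaban1987RG1, (3.21) p.274] -/
theorem continuousOn_fderiv_path {s : Set EB} (hs : IsOpen s) {f : EB → F} (hf : ContDiffOn ℝ 1 f s)
    (Z : EB →L[ℝ] EB) (q w : EB) (hseg : ∀ t ∈ Icc (0 : ℝ) 1, path Z q t ∈ s) :
    ContinuousOn (fun t : ℝ => fderiv ℝ f (path Z q t) w) (Icc (0 : ℝ) 1) := by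
  have hD : ContinuousOn (fderiv ℝ f) s := hf.continuousOn_fderiv_of_isOpen hs le_rfl
  have hcomp : ContinuousOn (fun t : ℝ => fderiv ℝ f (path Z q t)) (Icc (0 : ℝ) 1) :=
    hD.comp (continuous_path Z q).continuousOn fun t ht => hseg t ht
  exact (ContinuousLinearMap.apply ℝ F w).continuous.comp_continuousOn hcomp

omit [NormedAddCommGroup EH] [NormedSpace ℝ EH] in
/-- The fundamental theorem of calculus along the interpolation `A(t̃)`: for `f` of class C¹ on an open
`s ⊇ A([0,1])`, `f(Q) − f(ζ̃_□Q) = ∫₀¹ dt̃ ⟨Df(A(t̃)), (1 − ζ̃_□)Q⟩` — the mechanism of the first equality of (3.21).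
[cite: Balaban1987RG1, (3.21) p.274] -/
theorem ftc_path {s : Set EB} (hs : IsOpen s) {f : EB → F} (hf : ContDiffOn ℝ 1 f s) (Z : EB →L[ℝ] EB) (q : EB)
    (hseg : ∀ t ∈ Icc (0 : ℝ) 1, path Z q t ∈ s) :
    f q - f (Z q) = ∫ t in (0 : ℝ)..1, fderiv ℝ f (path Z q t) (q - Z q) := by
  have hdiff : ∀ t ∈ Icc (0 : ℝ) 1, DifferentiableAt ℝ f (path Z q t) := fun t ht =>
    (hf.differentiableOn one_ne_zero).differentiableAt (hs.mem_nhds (hseg t ht))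
  have hderiv : ∀ t ∈ uIcc (0 : ℝ) 1,
      HasDerivAt (fun τ : ℝ => f (path Z q τ)) (fderiv ℝ f (path Z q t) (q - Z q)) t := by
    intro t ht
    rw [uIcc_of_le zero_le_one] at ht
    exact (hdiff t ht).hasFDerivAt.comp_hasDerivAt t (hasDerivAt_path Z q t)
  have hint : IntervalIntegrable (fun t : ℝ => fderiv ℝ f (path Z q t) (q - Z q)) volume 0 1 := by
    refine ContinuousOn.intervalIntegrable ?_
    rw [uIcc_of_le zero_le_one]
    exact continuousOn_fderiv_path hs hf Z q (q - Z q) hseg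
  have h := intervalIntegral.integral_eq_sub_of_hasDerivAt hderiv hint
  simp only [path_one, path_zero] at h
  exact h.symm

variable {𝒰 𝒢 : Type*} [SMul 𝒢 𝒰]

omit [NormedAddCommGroup EH] [NormedSpace ℝ EH] in
/-- **(3.21), first equality** p. 274:
`𝐄^{(j)}(X, U_j(□₀, exp iQ(ξ𝐇_j(B_□))M˙(U_{k+1}))) = 𝐄^{(j)}(X, U_j(□₀, exp iζ̃_□B_□M˙(U_{k+1})))
 + ∫₀¹ dt̃ (d/dt̃) 𝐄^{(j)}(X, exp iξ𝐇_j(□₀, (t̃(1 − ζ̃_□) + ζ̃_□)Q(ξ𝐇_j(B_□)))U_{k+1})`.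
Here `rep0V A` = U_j(□₀, exp iA M˙(U_{k+1})), `chart 𝐇` = exp iξ𝐇 U_{k+1}, `Hj0` = 𝐇_j(□₀, ·), `q` = Q(ξ𝐇_j(B_□)),
`b` = B_□, `Z` = multiplication by ζ̃_□.  Inputs: gauge invariance `hE`; the □₀-local Sect. G representation `hrep0V`
on a domain `D₀ ∋ q, ζ̃_□b`; the localisation `hloc : ζ̃_□q = ζ̃_□b` (= (3.20) × «ζ̃_□ = 0 outside □̃⁴»,
`mulFn_eq_of_eq320`); `A ↦ 𝐄^{(j)}(X, exp iξ𝐇_j(□₀, A)U_{k+1})` of class C¹ on an open `s` containing the segment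
(print: analytic).  Mechanism: FTC (`ftc_path`), the ends being t̃ = 1 ↦ q and t̃ = 0 ↦ ζ̃_□q = ζ̃_□b.
[cite: Balaban1987RG1, (3.21) p.274] -/
theorem eq321_first {E : 𝒰 → F} (hE : ∀ (g : 𝒢) (U : 𝒰), E (g • U) = E U) {rep0V : EB → 𝒰}
    {chart : EH → 𝒰} {Hj0 : EB → EH} {D₀ : Set EB} (hrep0V : ∀ A ∈ D₀, ∃ g : 𝒢, rep0V A = g • chart (Hj0 A))
    {Z : EB →L[ℝ] EB} {q b : EB} (hloc : Z q = Z b) (hq : q ∈ D₀) (hZb : Z b ∈ D₀)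
    {s : Set EB} (hs : IsOpen s) (hseg : ∀ t ∈ Icc (0 : ℝ) 1, path Z q t ∈ s)
    (hGH : ContDiffOn ℝ 1 (fun A => E (chart (Hj0 A))) s) :
    E (rep0V q) = E (rep0V (Z b))
      + ∫ t in (0 : ℝ)..1, deriv (fun τ : ℝ => E (chart (Hj0 (path Z q τ)))) t := by
  have hdiff : ∀ t ∈ Icc (0 : ℝ) 1, DifferentiableAt ℝ (fun A => E (chart (Hj0 A))) (path Z q t) := fun t ht =>
    (hGH.differentiableOn one_ne_zero).differentiableAt (hs.mem_nhds (hseg t ht))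
  rw [eq36 hE hrep0V hq, eq36 hE hrep0V hZb, ← hloc]
  have hftc := ftc_path hs hGH Z q hseg
  have hcongr : (∫ t in (0 : ℝ)..1, fderiv ℝ (fun A => E (chart (Hj0 A))) (path Z q t) (q - Z q))
      = ∫ t in (0 : ℝ)..1, deriv (fun τ : ℝ => E (chart (Hj0 (path Z q τ)))) t := by
    refine intervalIntegral.integral_congr fun t ht => ?_
    rw [uIcc_of_le zero_le_one] at ht
    exact (((hdiff t ht).hasFDerivAt.comp_hasDerivAt t (hasDerivAt_path Z q t)).deriv).symm
  rw [← hcongr, ← hftc]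
  abel

/-- **(3.21)** p. 274, both equalities:
`𝐄^{(j)}(X, U_j(□₀, exp iQ(ξ𝐇_j(B_□))M˙(U_{k+1}))) = 𝐄^{(j)}(X, U_j(□₀, exp iζ̃_□B_□M˙(U_{k+1})))
 + ∫₀¹ dt̃ (d/dt̃_□) 𝐄^{(j)}(X, exp iξ[𝐇_j(□₀, A(t̃)) + t̃_□⟨((δ/δB)𝐇_j)(□₀, A(t̃)), (1 − ζ̃_□)Q(ξ𝐇_j(B_□))⟩]U_{k+1})|_{t̃_□=0}`,
`A(t̃) = (t̃(1 − ζ̃_□) + ζ̃_□)Q(ξ𝐇_j(B_□))` (`path`), `⟨((δ/δB)𝐇_j)(□₀, A), w⟩` = `fderiv ℝ Hj0 A w`; with `Hj0` =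
𝐇_j(□₀, ·) of class C¹ on an open `s` containing the segment and `Gc` = 𝐇 ↦ 𝐄^{(j)}(X, exp iξ𝐇U_{k+1}) of class C¹
on an open `s' ⊇ 𝐇_j(□₀, s)` (print: analyticity), the other inputs as in `eq321_first`.
[cite: Balaban1987RG1, (3.21) p.274] -/
theorem eq321 {E : 𝒰 → F} (hE : ∀ (g : 𝒢) (U : 𝒰), E (g • U) = E U) {rep0V : EB → 𝒰}
    {chart : EH → 𝒰} {Hj0 : EB → EH} {D₀ : Set EB} (hrep0V : ∀ A ∈ D₀, ∃ g : 𝒢, rep0V A = g • chart (Hj0 A))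
    {Z : EB →L[ℝ] EB} {q b : EB} (hloc : Z q = Z b) (hq : q ∈ D₀) (hZb : Z b ∈ D₀)
    {s : Set EB} (hs : IsOpen s) (hseg : ∀ t ∈ Icc (0 : ℝ) 1, path Z q t ∈ s) (hH : ContDiffOn ℝ 1 Hj0 s)
    {s' : Set EH} (hs' : IsOpen s') (hG : ContDiffOn ℝ 1 (fun H => E (chart H)) s') (hmaps : MapsTo Hj0 s s') :
    E (rep0V q) = E (rep0V (Z b))
      + ∫ t in (0 : ℝ)..1, deriv (fun τ : ℝ =>
          E (chart (Hj0 (path Z q t) + τ • fderiv ℝ Hj0 (path Z q t) (q - Z q)))) 0 := by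
  have hGH : ContDiffOn ℝ 1 (fun A => E (chart (Hj0 A))) s := hG.comp hH hmaps
  rw [eq321_first hE hrep0V hloc hq hZb hs hseg hGH]
  congr 1
  refine intervalIntegral.integral_congr fun t ht => ?_
  rw [uIcc_of_le zero_le_one] at ht
  have hHt : DifferentiableAt ℝ Hj0 (path Z q t) :=
    (hH.differentiableOn one_ne_zero).differentiableAt (hs.mem_nhds (hseg t ht))
  have hGt : DifferentiableAt ℝ (fun H => E (chart H)) (Hj0 (path Z q t)) :=
    (hG.differentiableOn one_ne_zero).differentiableAt (hs'.mem_nhds (hmaps (hseg t ht)))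
  exact deriv_comp_path_eq_tbox (Gc := fun H => E (chart H)) hHt hGt

end FTC

section BondModel

variable {ι : Type*} [Fintype ι] {V : Type*} [NormedAddCommGroup V] [NormedSpace ℝ V]
  {EH F : Type*} [NormedAddCommGroup EH] [NormedSpace ℝ EH] [NormedAddCommGroup F] [NormedSpace ℝ F]
  [CompleteSpace F] {𝒰 𝒢 : Type*} [SMul 𝒢 𝒰]

/-- **(3.20) ⇒ (3.21)** in the bond-function model: with `Z = mulFn V z` the multiplication by ζ̃_□ (values `z` at
the bonds), (3.20) on the neighbourhood `N` of □̃⁴ (`h320`) and «ζ̃_□ = 0 outside □̃⁴» (`hz`) give the localisation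
`ζ̃_□Q(ξ𝐇_j(B_□)) = ζ̃_□B_□`, whence (3.21) with the first term AT THE CONFIGURATION ζ̃_□B_□ as printed.
[cite: Balaban1987RG1, (3.21) p.274] -/
theorem eq321_of_eq320 {E : 𝒰 → F} (hE : ∀ (g : 𝒢) (U : 𝒰), E (g • U) = E U) {rep0V : (ι → V) → 𝒰}
    {chart : EH → 𝒰} {Hj0 : (ι → V) → EH} {D₀ : Set (ι → V)}
    (hrep0V : ∀ A ∈ D₀, ∃ g : 𝒢, rep0V A = g • chart (Hj0 A))
    {Qavg : EH → (ι → V)} {Hj : (ι → V) → EH} {N : Set ι} {b : ι → V} (h320 : Eq320 Qavg Hj N b)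
    {z : ι → ℝ} (hz : ∀ i ∉ N, z i = 0) (hq : Qavg (Hj b) ∈ D₀) (hZb : mulFn V z b ∈ D₀)
    {s : Set (ι → V)} (hs : IsOpen s) (hseg : ∀ t ∈ Icc (0 : ℝ) 1, path (mulFn V z) (Qavg (Hj b)) t ∈ s)
    (hH : ContDiffOn ℝ 1 Hj0 s) {s' : Set EH} (hs' : IsOpen s') (hG : ContDiffOn ℝ 1 (fun H => E (chart H)) s')
    (hmaps : MapsTo Hj0 s s') :
    E (rep0V (Qavg (Hj b))) = E (rep0V (mulFn V z b))
      + ∫ t in (0 : ℝ)..1, deriv (fun τ : ℝ =>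
          E (chart (Hj0 (path (mulFn V z) (Qavg (Hj b)) t)
            + τ • fderiv ℝ Hj0 (path (mulFn V z) (Qavg (Hj b)) t)
                (Qavg (Hj b) - mulFn V z (Qavg (Hj b)))))) 0 :=
  eq321 hE hrep0V (mulFn_eq_of_eq320 h320 hz) hq hZb hs hseg hH hs' hG hmaps

end BondModel

/-! ## §4. (3.22): the configuration `B̃_□` -/

section Btilde

variable {𝕜 : Type*} [NontriviallyNormedField 𝕜] {EA EB : Type*} [NormedAddCommGroup EA] [NormedSpace 𝕜 EA]

/-- **B̃_□** of (3.22) p. 274: `B̃_□ = Q_j(η(tζ̃_□ + t_□ζ_□)𝐇_k(B′))` — in the model of p. 271 (`B12FarTerms36.Bsq`: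
`Q` = 𝐀 ↦ Q_j(η𝐀), `x = t𝐇_k(B′)`, `v = ζ_□𝐇_k(B′)`, B_□ = `Q (x + t_□ • v)`), with `ZA` the multiplication by ζ̃_□ on
the fine fields, so that `ZA x + t_□ • v = (tζ̃_□ + t_□ζ_□)𝐇_k(B′)`. [cite: Balaban1987RG1, (3.22) p.274] -/
def Btilde (Q : EA → EB) (ZA : EA →L[𝕜] EA) (x v : EA) (τ : 𝕜) : EB :=
  Q (ZA x + τ • v)

/-- Unfolding of `B̃_□`. [cite: Balaban1987RG1, (3.22) p.274] -/
theorem Btilde_apply (Q : EA → EB) (ZA : EA →L[𝕜] EA) (x v : EA) (τ : 𝕜) :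
    Btilde Q ZA x v τ = Q (ZA x + τ • v) := rfl

/-- `B̃_□` is B_□ along the line through `ζ̃_□x` instead of `x`: `Btilde Q ZA x v = Bsq Q (ZA x) v`.
[cite: Balaban1987RG1, (3.22) p.274] -/
theorem Btilde_eq_Bsq (Q : EA → EB) (ZA : EA →L[𝕜] EA) (x v : EA) (τ : 𝕜) :
    Btilde Q ZA x v τ = Bsq Q (ZA x) v τ := rfl

/-- At `t_□ = 0`: `B̃_□|_{t_□=0} = Q_j(ηtζ̃_□𝐇_k(B′))`. [cite: Balaban1987RG1, (3.22) p.274] -/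
@[simp] theorem Btilde_zero (Q : EA → EB) (ZA : EA →L[𝕜] EA) (x v : EA) : Btilde Q ZA x v (0 : 𝕜) = Q (ZA x) := by
  simp [Btilde]

/-- `(tζ̃_□)𝐇 = ζ̃_□(t𝐇)`: along the ray `x = t • H` of (3.4) the point `ZA x` is `t • ZA H` (linearity of the
multiplication by ζ̃_□), i.e. `B̃_□ = Q_j(η(tζ̃_□ + t_□ζ_□)𝐇_k(B′))` literally. [cite: Balaban1987RG1, (3.22) p.274] -/
theorem Btilde_ray (Q : EA → EB) (ZA : EA →L[𝕜] EA) (t : 𝕜) (H v : EA) (τ : 𝕜) :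
    Btilde Q ZA (t • H) v τ = Q (t • ZA H + τ • v) := by
  simp [Btilde, map_smul]

/-- **(3.22)** p. 274: *«Taking into account the definition of B_□, we write
ζ̃_□B_□ = [ζ̃_□Q_j(η(t + t_□ζ_□)𝐇_k(B′)) − Q_j(η(tζ̃_□ + t_□ζ_□)𝐇_k(B′))] + B̃_□, B̃_□ = Q_j(η(tζ̃_□ + t_□ζ_□)𝐇_k(B′))»* —
with `Z` the multiplication by ζ̃_□ on the `B`-fields and B_□ = `Bsq Q x v t_□` = Q_j(η(t + t_□ζ_□)𝐇_k(B′)).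
[cite: Balaban1987RG1, (3.22) p.274] -/
theorem eq322 [NormedAddCommGroup EB] [NormedSpace 𝕜 EB] (Z : EB →L[𝕜] EB) (Q : EA → EB) (ZA : EA →L[𝕜] EA)
    (x v : EA) (τ : 𝕜) :
    Z (Bsq Q x v τ) = (Z (Q (x + τ • v)) - Q (ZA x + τ • v)) + Btilde Q ZA x v τ := by
  simp only [Bsq_apply, Btilde]
  abel

end Btilde

/-! ## §5. (3.23) -/

section Eq323

variable {𝒰 𝒱 EB F : Type*}

/-- **(3.23)** p. 274: *«Thus we consider the expression
𝐄^{(j)}(X, U_j(□₀, exp iB̃_□ M˙(U_{k+1}))) = 𝐄^{(j)}(X, U_j(□₀, exp iB̃_□ M˙(U_{k+1}(□₀, M˙(U_{k+1})))))»* (p. 275: «This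
equality is connected with the way we introduce the variables 𝐔, 𝐉, namely in the interior averages M˙(U_{k+1}) we
replace the configuration U_{k+1} by 𝐔») — immediate from the constraint input `hconstr`: the cond-(iv) function
`rep1` = U_{k+1}(□₀, ·) evaluated at the interior averages `M U` = M˙(U_{k+1}) has again the interior averages
M˙(U_{k+1}) ([14]; typed as a hypothesis, not reproduced).  `E` = 𝐄^{(j)}(X, ·), `rep0` = U_j(□₀, ·), `act Bt W` =
exp iB̃_□ W, `U` = U_{k+1}. [cite: Balaban1987RG1, (3.23) p.274] -/
theorem eq323 (E : 𝒰 → F) (rep0 : 𝒱 → 𝒰) (act : EB → 𝒱 → 𝒱) (Bt : EB) {M : 𝒰 → 𝒱} {rep1 : 𝒱 → 𝒰} {U : 𝒰}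
    (hconstr : M (rep1 (M U)) = M U) :
    E (rep0 (act Bt (M U))) = E (rep0 (act Bt (M (rep1 (M U))))) := by
  rw [hconstr]

end Eq323

/-! ## §6. The sentence after (3.21): `dist^{(ξ)}(X, supp(1 − ζ̃_□)) ≥ M(Lʲη)⁻¹` and the small factor `O((Lʲη)ᴺ)` -/

section SmallFactor

/-- Geometry of «the condition dist^{(ξ)}(X, supp(1 − ζ̃_□)) ≥ M(Lʲη)⁻¹» for `X ⊂ □̃²`: with □̃ⁿ the closed metric
thickening `cthickening (nR₀) □` (R₀ = M(Lʲη)⁻¹, as in `B12Cubes436`), every point of □̃² is at distance `≥ R₀`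
from every point of the closure of (□̃³)ᶜ — which contains supp(1 − ζ̃_□) since «ζ̃_□ = 1 on □̃³».  Any pseudo-metric
space. [cite: Balaban1987RG1, (3.21) p.274] -/
theorem le_dist_of_tilde2_of_closure_compl_tilde3 {α : Type*} [PseudoMetricSpace α] (B : Set α) {R₀ : ℝ}
    (hR₀ : 0 ≤ R₀) {x y : α} (hx : x ∈ cthickening (2 * R₀) B) (hy : y ∈ closure (cthickening (3 * R₀) B)ᶜ) :
    R₀ ≤ dist x y := by
  have hclosed : IsClosed {w : α | R₀ ≤ dist x w} :=
    isClosed_le continuous_const (continuous_const.dist continuous_id)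
  have hsub : (cthickening (3 * R₀) B)ᶜ ⊆ {w : α | R₀ ≤ dist x w} := by
    intro w hw
    by_contra hlt
    simp only [mem_setOf_eq, not_le] at hlt
    apply hw
    have h1 : w ∈ cthickening R₀ (cthickening (2 * R₀) B) :=
      mem_cthickening_of_dist_le w x R₀ _ hx (by rw [dist_comm]; exact hlt.le)
    have h2 := cthickening_cthickening_subset hR₀ (by positivity : (0 : ℝ) ≤ 2 * R₀) B h1
    have h3 : R₀ + 2 * R₀ = 3 * R₀ := by ring
    rw [h3] at h2
    exact h2
  exact closure_minimal hsub hclosed hy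

/-- With `X ⊂ □̃²` and `supp(1 − ζ̃_□) ⊆ closure (□̃³)ᶜ`: `dist(x, y) ≥ R₀` for all `x ∈ X`, `y ∈ supp(1 − ζ̃_□)`.
[cite: Balaban1987RG1, (3.21) p.274] -/
theorem le_dist_of_subset_tilde2 {α : Type*} [PseudoMetricSpace α] (B : Set α) {R₀ : ℝ} (hR₀ : 0 ≤ R₀)
    {X S : Set α} (hX : X ⊆ cthickening (2 * R₀) B) (hS : S ⊆ closure (cthickening (3 * R₀) B)ᶜ) :
    ∀ x ∈ X, ∀ y ∈ S, R₀ ≤ dist x y := fun _ hx _ hy =>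
  le_dist_of_tilde2_of_closure_compl_tilde3 B hR₀ (hX hx) (hS hy)

/-- *«… we obtain a bound of the type (3.9) for the expression ⟨…⟩ under the exponential. Thus a bound for the second
term above has the small factor O((Lʲη)ᴺ)»* — the arithmetic: a bound `|T| ≤ K·exp(−½δ₀·D)` with the decay distance
`D = dist^{(ξ)}(X, supp(1 − ζ̃_□)) ≥ M(Lʲη)⁻¹` (`x` = Lʲη) gives `|T| ≤ K·(N!/(½δ₀M)ᴺ)·(Lʲη)ᴺ` for every `N`
(`B12.exp_neg_inv_le_pow`). [cite: Balaban1987RG1, (3.21) p.274] -/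
theorem smallFactor321 {K δ₀ M D x T : ℝ} (hK : 0 ≤ K) (hδ₀ : 0 < δ₀) (hM : 0 < M) (hx : 0 < x)
    (hT : |T| ≤ K * Real.exp (-(δ₀ / 2) * D)) (hD : M * x⁻¹ ≤ D) (N : ℕ) :
    |T| ≤ K * ((N ! : ℝ) / (δ₀ / 2 * M) ^ N) * x ^ N := by
  have hc : 0 < δ₀ / 2 * M := by positivity
  have hmono : Real.exp (-(δ₀ / 2) * D) ≤ Real.exp (-(δ₀ / 2 * M * x⁻¹)) := by
    apply Real.exp_le_exp.mpr
    have : δ₀ / 2 * (M * x⁻¹) ≤ δ₀ / 2 * D := mul_le_mul_of_nonneg_left hD (by positivity)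
    nlinarith
  have hpow := B12.exp_neg_inv_le_pow hc hx N
  calc |T| ≤ K * Real.exp (-(δ₀ / 2) * D) := hT
    _ ≤ K * Real.exp (-(δ₀ / 2 * M * x⁻¹)) := mul_le_mul_of_nonneg_left hmono hK
    _ ≤ K * ((N ! : ℝ) / (δ₀ / 2 * M) ^ N * x ^ N) := mul_le_mul_of_nonneg_left hpow hK
    _ = K * ((N ! : ℝ) / (δ₀ / 2 * M) ^ N) * x ^ N := by ring

end SmallFactor

/-! ## §7 (v1.1, append-only, unit `lit-balaban-r09` generation 4). p. 274, the sentence after (3.22):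
«The expression is localized in □̃⁴∖□̃³» — PROVED in the bond-function model of §2/§4 from the LOCALITY of the averaging

p. 274, verbatim: *«We remove the expression in the square brackets [...] repeating the procedure in (3.21). The
expression is localized in □̃⁴∖□̃³, and the term corresponding to the second term in (3.21) has a very similar form and
the same properties, so we apply the same considerations as before.»*  (ζ̃_□ ∈ C₀^∞(□₀), ζ̃_□ = 1 on □̃³, ζ̃_□ = 0
outside □̃⁴ — p. 274, before (3.21).)

MODEL (that of `Bsq`/`Btilde` with function spaces).  Fine fields `ι' → V` (the 𝐇-fields), coarse fields `ι → V` (the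
B-fields), the averaging `Q : (ι' → V) → (ι → V)` (𝐀 ↦ Q_j(η𝐀)) with `Q 0 = 0` and its LOCALITY as a Mathlib `DependsOn`
hypothesis — the value `Q 𝐀 b` depends on `𝐀` restricted to a set `nb b` of fine bonds (the averaging neighbourhood of
the bond `b`, [15]); both are hypotheses, never asserted.  The cut-off ζ̃_□ enters (3.22) twice: sampled on the coarse
bonds (`zt : ι → 𝕜`, multiplying B-fields: `mulFn V zt`) and on the fine bonds (`zt' : ι' → 𝕜`, multiplying 𝐇-fields:
`ZA = mulFn V zt'`).  The square bracket of (3.22) is the coarse field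
`mulFn V zt (Bsq Q x v t_□) - Btilde Q (mulFn V zt') x v t_□`, i.e. at a bond `b`:
ζ̃_□(b)Q_j(η(t + t_□ζ_□)𝐇_k(B′))(b) − Q_j(η(tζ̃_□ + t_□ζ_□)𝐇_k(B′))(b) (`x = t𝐇_k(B′)`, `v = ζ_□𝐇_k(B′)`;
`bracket322_ray_apply` displays it in the printed variables).

WHAT IS PROVED.  `bracket322_apply_eq_zero_of_one`: at a bond `b` with ζ̃_□(b) = 1 and ζ̃_□ = 1 on `nb b` the bracket
vanishes (both terms are Q_j(η(t + t_□ζ_□)𝐇_k(B′))(b) by locality) — the bonds of □̃³.  `bracket322_apply_eq_zero_of_zero`: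
at a bond `b` with ζ̃_□(b) = 0 and ζ̃_□ = 0, ζ_□𝐇 = 0 on `nb b` the bracket vanishes (the first term carries the factor
ζ̃_□(b) = 0, the second is Q(0)(b) = 0 by locality) — the bonds outside □̃⁴.  `support_bracket322_subset`: hence the
support of the bracket lies in `N₄ \ N₃` for any two sets of coarse bonds with these two properties (hypotheses `h3`,
`h4`: the printed □̃³ and □̃⁴ enter the model only through them).  NOT HERE: «the term corresponding to the second term
in (3.21)» — the interpolation (3.21) repeated for the bracket is `eq321` of §3 with the bracket's own end-points, not
re-instantiated; the bound «of the type (3.9)» for it is analytic input as before. -/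

section Locality322

variable {𝕜 : Type*} [NontriviallyNormedField 𝕜] {ι ι' : Type*} [Fintype ι']
  {V : Type*} [NormedAddCommGroup V] [NormedSpace 𝕜 V]

/-- The square bracket of (3.22) in the printed variables: with `x = t𝐇`, `v = ζ_□𝐇` (ζ_□ sampled on the fine bonds as
`z'`), at a coarse bond `b` it reads `ζ̃_□(b)·Q((t + t_□ζ_□)𝐇)(b) − Q((tζ̃_□ + t_□ζ_□)𝐇)(b)` (η absorbed in `Q`).
[cite: Balaban1987RG1, (3.22) p.274] -/
theorem bracket322_ray_apply (Q : (ι' → V) → (ι → V)) (zt : ι → 𝕜) (zt' z' : ι' → 𝕜) (H : ι' → V) (t τ : 𝕜)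
    (b : ι) :
    (mulFn V zt (Bsq Q (t • H) (mulFn V z' H) τ) - Btilde Q (mulFn V zt') (t • H) (mulFn V z' H) τ) b
      = zt b • Q (fun b' => (t + τ * z' b') • H b') b - Q (fun b' => (t * zt' b' + τ * z' b') • H b') b := by
  have hX : t • H + τ • mulFn V z' H = fun b' => (t + τ * z' b') • H b' := by
    ext b'
    simp [mulFn_apply, add_smul, smul_smul]
  have hY : mulFn V zt' (t • H) + τ • mulFn V z' H = fun b' => (t * zt' b' + τ * z' b') • H b' := by
    ext b'
    simp [mulFn_apply, add_smul, smul_smul, mul_comm t]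
  simp only [Pi.sub_apply, mulFn_apply, Bsq_apply, Btilde_apply, hX, hY]

/-- **Inside □̃³ the bracket of (3.22) vanishes**: at a coarse bond `b` with ζ̃_□(b) = 1 and ζ̃_□ = 1 on the averaging
neighbourhood `nb b`, locality of `Q` gives Q_j(η(tζ̃_□ + t_□ζ_□)𝐇)(b) = Q_j(η(t + t_□ζ_□)𝐇)(b), so
`ζ̃_□(b)B_□(b) − B̃_□(b) = 0`. [cite: Balaban1987RG1, (3.22) p.274] -/
theorem bracket322_apply_eq_zero_of_one {Q : (ι' → V) → (ι → V)} {nb : ι → Set ι'}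
    (hloc : ∀ b, DependsOn (fun A => Q A b) (nb b)) (zt : ι → 𝕜) {zt' : ι' → 𝕜} (x v : ι' → V) (τ : 𝕜)
    {b : ι} (hb : zt b = 1) (hnb : ∀ b' ∈ nb b, zt' b' = 1) :
    (mulFn V zt (Bsq Q x v τ) - Btilde Q (mulFn V zt') x v τ) b = 0 := by
  have h : Q (mulFn V zt' x + τ • v) b = Q (x + τ • v) b :=
    hloc b fun b' hb' => by simp [mulFn_apply, hnb b' hb']
  simp [Bsq_apply, Btilde_apply, mulFn_apply, hb, h]

/-- **Outside □̃⁴ the bracket of (3.22) vanishes**: at a coarse bond `b` with ζ̃_□(b) = 0 and ζ̃_□ = 0, ζ_□𝐇 = 0 on the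
averaging neighbourhood `nb b`, the first term carries the factor ζ̃_□(b) = 0 and the second is
Q_j(η(tζ̃_□ + t_□ζ_□)𝐇)(b) = Q_j(0)(b) = 0 by locality. [cite: Balaban1987RG1, (3.22) p.274] -/
theorem bracket322_apply_eq_zero_of_zero {Q : (ι' → V) → (ι → V)} {nb : ι → Set ι'}
    (hloc : ∀ b, DependsOn (fun A => Q A b) (nb b)) (hQ0 : Q 0 = 0) {zt : ι → 𝕜} {zt' : ι' → 𝕜} (x : ι' → V)
    {v : ι' → V} (τ : 𝕜) {b : ι} (hb : zt b = 0) (hnb : ∀ b' ∈ nb b, zt' b' = 0) (hv : ∀ b' ∈ nb b, v b' = 0) :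
    (mulFn V zt (Bsq Q x v τ) - Btilde Q (mulFn V zt') x v τ) b = 0 := by
  have h : Q (mulFn V zt' x + τ • v) b = Q 0 b :=
    hloc b fun b' hb' => by simp [mulFn_apply, hnb b' hb', hv b' hb']
  simp [Bsq_apply, Btilde_apply, mulFn_apply, hb, h, hQ0]

/-- **«The expression is localized in □̃⁴∖□̃³»** (p. 274, after (3.22)), in the model: if ζ̃_□ = 1 at and around (on the
averaging neighbourhoods of) the bonds of `N₃` (= □̃³), and ζ̃_□ = 0, ζ_□𝐇 = 0 at and around the bonds off `N₄` (= □̃⁴),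
then the square bracket `ζ̃_□B_□ − B̃_□` of (3.22) is supported in `N₄ \ N₃`.  From the locality of the averaging and
`Q(0) = 0`. [cite: Balaban1987RG1, (3.22) p.274] -/
theorem support_bracket322_subset {Q : (ι' → V) → (ι → V)} {nb : ι → Set ι'}
    (hloc : ∀ b, DependsOn (fun A => Q A b) (nb b)) (hQ0 : Q 0 = 0) {zt : ι → 𝕜} {zt' : ι' → 𝕜} {v : ι' → V}
    {N₃ N₄ : Set ι} (h3 : ∀ b ∈ N₃, zt b = 1 ∧ ∀ b' ∈ nb b, zt' b' = 1)
    (h4 : ∀ b ∉ N₄, zt b = 0 ∧ ∀ b' ∈ nb b, zt' b' = 0 ∧ v b' = 0) (x : ι' → V) (τ : 𝕜) :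
    Function.support (mulFn V zt (Bsq Q x v τ) - Btilde Q (mulFn V zt') x v τ) ⊆ N₄ \ N₃ := by
  intro b hb
  rw [Function.mem_support] at hb
  refine ⟨by_contra fun h4b => hb ?_, fun h3b => hb ?_⟩
  · obtain ⟨hz, hnb⟩ := h4 b h4b
    exact bracket322_apply_eq_zero_of_zero hloc hQ0 x τ hz (fun b' hb' => (hnb b' hb').1)
      fun b' hb' => (hnb b' hb').2
  · obtain ⟨hz, hnb⟩ := h3 b h3b
    exact bracket322_apply_eq_zero_of_one hloc zt x v τ hz hnb

end Locality322

end Literature.MathematicalPhysics.QuantumFieldTheory.Balaban1983to89.B12NearTerms321
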